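import Literature.NumberTheory.Automorphic.Liu2021.LemD1AsPrintedIndexedNonVacuityInertCarrier
import HarnessLib

/-!
# [Liu2021, App. D Lemma D.1 (1) ∧ (3)] AS PRINTED with the `ε`-conjunct ALONE separating at INERT TAME places of ANY quadratic `E/F`
# (`gcd(N, q_v + 1) > 1`), and at every non-split place carrying a global norm-one unit `ζ` with `v_w(ζ^N − 1) < v_w(ζ − 1)`

Reproduction ∕ bookkeeping (Literature, THEOREMS ONLY: no definition, no record, no named fact, no `sorry`; nothing is
asserted about Liu's oscillator representations or about the tree's constructed local Weil carriers).

Sequel of ✔ `…EpsAlone.lean`, whose «What this does NOT give» opens with «an `ε`-alone model at a non-split place carrying NO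
centre-trivial character of the kind above (`v_w(N) = 1`, no norm-one torsion off `w`)», and of ✔ `…InertCarrier.lean`, which supplies
such a character at every INERT place (`v` unramified in `E`, `c • w = w`) with `gcd(N, q_v + 1) > 1` (and, generally, at every non-split
place from ANY global norm-one unit `ζ` with `v_w(ζ − 1) ≠ 0`, `v_w(ζ^N − 1) < v_w(ζ − 1)`).  THIS FILE plugs the second into the `ε`-alone
family of the first (copied, private):

* §1 **`exists_lemD1IndexedFamily_item1_and_lemD1_3_eps_of_norm_one`** (non-split `w`, general `ζ`) and
  **`exists_lemD1IndexedFamily_item1_and_lemD1_3_eps_of_inert`** (inert `w`, `N` not coprime to `q_v + 1`): for every `μ ∈ MuSet S` and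
  every representative `e` there is an INEQUIVALENT representative `e'` (✔ `…NonsplitPlace.exists_epsRep_not_sameClass_of_nonsplit`) and the
  two-member collection with labels `(μ, e, 1)`, `(μ, e', 1)` — SAME `μ`, SAME `χ = 1` — and carriers the trivial line and the line of the
  carrier character `Ψ` of ✔ `…InertCarrier` satisfies [Lem. D.1, first sentence + (1)] AS PRINTED member by member AND [Lem. D.1 (3)] AS
  PRINTED for all four pairs; exactly the `ε`-conjunct fails; the `ω`'s are non-isomorphic with EQUAL central characters; hypothesis-free
  consequences **`not_forall_sameClass_of_mu_eq_of_chi_eq_of_norm_one`** ∕ **`…_of_inert`** (every `N ≥ 3`).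
* §2 the CM rows (`L` CM, both members carrying the rows' OWN `μ_v = localMu L (toHeckeCharacter L ψ) v`):
  `exists_lemD1IndexedFamily_item1_and_lemD1_3_localMu_eps_of_inert`, `not_forall_sameClass_of_mu_eq_of_chi_eq_of_isCMField_of_inert`, and
  THE END's `3 ∣ N` at every inert place `v` of `L⁺` (unramified in `L`) with `q_v ≡ 2 (mod 3)`: `…_of_isCMField_of_three_dvd`.

Picture for an auditor of the END rows `hD1''` ∕ `hD3` (our bookkeeping, not a claim about Liu's objects): with ✔ `…EpsAlone` (wild ∕ torsion)
and this file, the `ε`-conjunct of [Lem. D.1 (3)] AS PRINTED is certified to be INDEPENDENT of the other two at every non-split place that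
carries a det-line centre-trivial character — for `N = 3` and ANY CM `L`: every non-split place above `3` and every inert `v ∤ 𝔡_{L/L⁺}` with
`q_v ≡ 2 (mod 3)`; at SPLIT places the `ε`-conjunct is identically true (✔ `…EpsAlone.forall_sameClass_of_split`).

What this does NOT give: an `ε`-alone model at inert places with `gcd(N, q_v(q_v + 1)) = 1` or at ramified non-split places; anything
about the rows' OWN carriers `𝓢.omegaLoc v`; Lem. D.1 itself.  HC_CM is NOT proved.

Cell pub-hodgecm2 (COR-CM), audit class of the END rows `hD1''` ∕ `hD3`; seat prover-pub-hodgecm2-b10.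

References: [Liu2021] Y. Liu, *Fourier–Jacobi cycles and arithmetic relative trace formula*, Camb. J. Math. 9 (2021) =
arXiv:2102.11518, App. D §D.1 Step 1 (l. 5217), Steps 2–3 (l. 5219–5221), Lemma D.1 (1) (l. 5229), (3) (l. 5233), Def. 4.11 (l. 2086);
[NeukirchANT1999] J. Neukirch, *Algebraic Number Theory* (1999), Ch. I §9 Exercise 2, Ch. II §3 Prop. (3.10); [Mok2014] C. P. Mok,
Mem. AMS 235 (2015), §1 Notation p. 5.
-/

noncomputable section

open scoped Matrix MatrixGroups
open NumberField IsDedekindDomain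
open Literature.RepresentationTheory
open Literature.RepresentationTheory.Liu2021 (OscillatorStandingData)
open Literature.RepresentationTheory.CentralCharacterQuotient (augmentation quotRep quotRep_mk)
open Literature.NumberTheory.GaloisRepresentations (HeckeCharacter)

namespace Literature.NumberTheory.Automorphic.Liu2021.LemD1IndexedNonVacuityInertEpsAlone

open UnitaryGroup

/-! ## §0 Line carriers: the bookkeeping lemmas (copies of the siblings' private lemmas) -/

/-- For a datum whose carrier is the line `ℂ` with `U(V)(F)` acting through a character `λ` that agrees with `χ` on the centre,
the `χ`-augmentation submodule vanishes (copy of the siblings' private lemma). [folklore] -/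
private theorem augmentation_eq_bot_of_character {F₀ E₀ : Type} [Field F₀] [ValuativeRel F₀] [TopologicalSpace F₀]
    [CommRing E₀] [Algebra F₀ E₀] [TopologicalSpace E₀] {n : ℕ} (L : LemD1Data F₀ E₀ n ℂ) (lam : L.S.U →* ℂˣ)
    (hω : ∀ (g : L.S.U) (x : ℂ), L.omega g x = (lam g : ℂ) * x)
    (hcen : ∀ z : L.S.normOne, lam (L.S.scalar z) = L.chi z) :
    augmentation L.omega L.S.scalar L.chi = ⊥ := by
  unfold augmentation
  refine iSup_eq_bot.2 fun z => ?_
  rw [LinearMap.range_eq_bot]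
  ext
  simp [hω, hcen]

/-- Two lines on which a group acts through characters `λ₁` and `λ₀` with `λ₁ g₀ ≠ λ₀ g₀` for some `g₀` have NON-isomorphic maximal
`χ`-quotients (the first quotient being the line itself).  Copy of the siblings' private lemma. [folklore] -/
private theorem not_areIsomorphicRep_quotRep_of_characters {G Z : Type*} [Group G] [Group Z]
    (ρ₁ ρ₀ : Representation ℂ G ℂ) {ζ : Z →* G} (hζ : ∀ z, ζ z ∈ Subgroup.center G) (χ₁ χ₀ : Z →* ℂˣ)
    (lam₁ lam₀ : G →* ℂˣ) (h₁ : ∀ (g : G) (x : ℂ), ρ₁ g x = (lam₁ g : ℂ) * x) (h₀ : ∀ (g : G) (x : ℂ), ρ₀ g x = (lam₀ g : ℂ) * x)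
    (hN₁ : augmentation ρ₁ ζ χ₁ = ⊥) {g₀ : G} (hg₀ : lam₁ g₀ ≠ lam₀ g₀) :
    ¬ AreIsomorphicRep (quotRep ρ₁ hζ χ₁) (quotRep ρ₀ hζ χ₀) := by
  rintro ⟨f, hf⟩
  have hw0 : (Submodule.Quotient.mk 1 : ℂ ⧸ augmentation ρ₁ ζ χ₁) ≠ 0 := by
    rw [Ne, Submodule.Quotient.mk_eq_zero, hN₁, Submodule.mem_bot]
    exact one_ne_zero
  have h1 : quotRep ρ₁ hζ χ₁ g₀ (Submodule.Quotient.mk 1) =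
      (lam₁ g₀ : ℂ) • (Submodule.Quotient.mk 1 : ℂ ⧸ augmentation ρ₁ ζ χ₁) := by
    rw [quotRep_mk, h₁, ← smul_eq_mul, Submodule.Quotient.mk_smul]
  have h2 : ∀ y : ℂ ⧸ augmentation ρ₀ ζ χ₀, quotRep ρ₀ hζ χ₀ g₀ y = (lam₀ g₀ : ℂ) • y := by
    intro y
    obtain ⟨u, rfl⟩ := Submodule.Quotient.mk_surjective _ y
    rw [quotRep_mk, h₀, ← smul_eq_mul, Submodule.Quotient.mk_smul]
  have key := hf g₀ (Submodule.Quotient.mk 1)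
  rw [h1, h2, map_smul] at key
  have hsub : ((lam₁ g₀ : ℂ) - lam₀ g₀) • f (Submodule.Quotient.mk 1) = 0 := by
    rw [sub_smul, key, sub_self]
  rcases smul_eq_zero.1 hsub with h | h
  · exact hg₀ (Units.ext (sub_eq_zero.1 h))
  · exact hw0 (f.injective (by rw [h, map_zero]))

/-- **Item (1) AS PRINTED holds at a character datum of rank `n ≠ 2`** (copy of the siblings' private lemma).
[cite: Liu2021, App. D Lemma D.1 (1) (l. 5229)] -/
private theorem lemD1_1AsPrinted_of_character_of_rank_ne_two' {F₀ E₀ : Type} [Field F₀] [ValuativeRel F₀]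
    [TopologicalSpace F₀] [CommRing E₀] [Algebra F₀ E₀] [TopologicalSpace E₀] [IsTopologicalRing E₀] {n₀ : ℕ}
    (L : LemD1Data F₀ E₀ n₀ ℂ) (lam : L.S.U →* ℂˣ) (hω : ∀ (g : L.S.U) (x : ℂ), L.omega g x = (lam g : ℂ) * x)
    (hcen : ∀ z : L.S.normOne, lam (L.S.scalar z) = L.chi z)
    (hopen : ∃ O : Set L.S.U, IsOpen O ∧ (1 : L.S.U) ∈ O ∧ ∀ g ∈ O, lam g = 1) (hn : n₀ ≠ 2) :
    LemD1_1AsPrinted L := by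
  have hN : augmentation L.omega L.S.scalar L.chi = ⊥ := augmentation_eq_bot_of_character L lam hω hcen
  have hfin : Module.finrank ℂ (ℂ ⧸ augmentation L.omega L.S.scalar L.chi) = 1 := by
    rw [(Submodule.quotEquivOfEqBot _ hN).finrank_eq, Module.finrank_self]
  haveI hsimple : IsSimpleModule ℂ (ℂ ⧸ augmentation L.omega L.S.scalar L.chi) :=
    isSimpleModule_iff_finrank_eq_one.2 hfin
  have hact : ∀ (g : L.S.U) (w : ℂ ⧸ augmentation L.omega L.S.scalar L.chi),
      L.datum.quot g w = (lam g : ℂ) • w := by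
    intro g w
    obtain ⟨y, rfl⟩ := Submodule.Quotient.mk_surjective _ w
    rw [LemD1Data.datum_quot, quotRep_mk, hω, ← smul_eq_mul, Submodule.Quotient.mk_smul]
  refine ⟨⟨?_, ?_, ?_⟩, ?_⟩
  · intro W
    rcases eq_bot_or_eq_top W.toSubmodule with h | h
    · exact Or.inl (Subrepresentation.toSubmodule_injective h)
    · exact Or.inr (Subrepresentation.toSubmodule_injective h)
  · intro x
    obtain ⟨O, hO, h1O, hlam⟩ := hopen
    change IsOpen (L.datum.quot.stabilizerSubgroup x : Set L.S.U)
    refine Subgroup.isOpen_of_mem_nhds _ (g := 1) (Filter.mem_of_superset (hO.mem_nhds h1O) fun g hg => ?_)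
    change L.datum.quot g x = x
    rw [hact, hlam g hg, Units.val_one, one_smul]
  · intro K _
    infer_instance
  · refine iff_of_false ?_ ?_
    · rw [not_subsingleton_iff_nontrivial]
      exact Module.nontrivial_of_finrank_pos (R := ℂ) (by rw [hfin]; exact one_pos)
    · exact fun h => hn h.2.1.2

/-- symmetry of «same class in `E^{−×}/Nm E^×`» (copy of the sibling's private lemma). [cite: Liu2021, App. D §D.1 Step 1 (l. 5217)] -/
private theorem sameClass_symm {F₀ E₀ : Type} [Field F₀] [CommRing E₀] [Algebra F₀ E₀] {n : ℕ} {S : OscillatorStandingData F₀ E₀ n}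
    {e e' : LemD1.EpsRep S} (h : LemD1.SameClass e e') : LemD1.SameClass e' e := by
  obtain ⟨x, hx⟩ := h
  exact ⟨x⁻¹, by rw [map_inv, hx, ← mul_inv, inv_mul_cancel_left]⟩

/-! ## §1 The JOINT certificate «(1) ∧ (3)» with the `ε`-conjunct ALONE separating — non-split places with a global norm-one unit; inert places -/

section PlaceModel

variable {F : Type} (E : Type) [Field F] [NumberField F] [Field E] [NumberField E] [Algebra F E]
  [Algebra.IsQuadraticExtension F E] (v : HeightOneSpectrum (𝓞 F)) (c : E ≃ₐ[F] E)
  {δ : E} (hcδ : c δ = -δ) (hδ : δ ≠ 0)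
  (N : ℕ) (J : Matrix (Fin N) (Fin N) E) (hN : 2 ≤ N) (hJh : (J.map c)ᵀ = J) (hJdet : J.det ≠ 0)

/-- **the `ε`-alone family from ANY centre-trivial character `Ψ` of `U(V)(F_v)` with an open kernel neighbourhood and a non-trivial value, and
two INEQUIVALENT representatives `e ≁ e'`**: labels `(μ, e, 1)`, `(μ, e', 1)` — SAME `μ`, SAME `χ = 1` —, carriers the trivial line and the line
of `Ψ`; (1) member by member, (3) for all four pairs, exactly the `ε`-conjunct failing, the `ω`'s non-isomorphic with equal central characters
(copy of the sibling's private construction). [cite: Liu2021, App. D Lemma D.1 (1) and (3) (l. 5229, 5233)] -/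
private theorem exists_family_eps_of_central_trivial_character (h3 : 3 ≤ N)
    (μ : LemD1.MuSet (LemD1OfPlace.standingData E v c N J hcδ hδ hN hJh hJdet))
    (e e' : LemD1.EpsRep (LemD1OfPlace.standingData E v c N J hcδ hδ hN hJh hJdet)) (hee' : ¬ LemD1.SameClass e e')
    (Ψ : (LemD1OfPlace.standingData E v c N J hcδ hδ hN hJh hJdet).U →* ℂˣ)
    (hcen : ∀ z : (LemD1OfPlace.standingData E v c N J hcδ hδ hN hJh hJdet).normOne,
      Ψ ((LemD1OfPlace.standingData E v c N J hcδ hδ hN hJh hJdet).scalar z) = 1)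
    (hopen : ∃ O : Set (LemD1OfPlace.standingData E v c N J hcδ hδ hN hJh hJdet).U, IsOpen O ∧ 1 ∈ O ∧ ∀ g ∈ O, Ψ g = 1)
    (hne : ∃ g₀ : (LemD1OfPlace.standingData E v c N J hcδ hδ hN hJh hJdet).U, Ψ g₀ ≠ 1) :
    ∃ Lf : LemD1IndexedFamily (v.adicCompletion F) (LocalRing E v) N (Fin 2),
      Lf.S = LemD1OfPlace.standingData E v c N J hcδ hδ hN hJh hJdet ∧
      (Lf.eps 0).1 = e.1 ∧ (Lf.eps 1).1 = e'.1 ∧ (∀ i, (Lf.mu i).1 = μ.1) ∧ (∀ i, (Lf.chi i).1 = 1) ∧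
      Lf.Item1AsPrinted ∧ LemD1_3AsPrintedI Lf ∧
      Lf.mu 0 = Lf.mu 1 ∧ ¬ LemD1.SameClass (Lf.eps 0) (Lf.eps 1) ∧ Lf.chi 0 = Lf.chi 1 ∧
      ¬ AreIsomorphicRep (Lf.quot 1) (Lf.quot 0) := by
  classical
  have hN2 : N ≠ 2 := by omega
  obtain ⟨g₀, hΨg₀⟩ := hne
  let S := LemD1OfPlace.standingData E v c N J hcδ hδ hN hJh hJdet
  let χ₀ : LemD1.ChiSet S := ⟨1, fun z => by simp, by simpa using continuous_const⟩
  let ω₀ : Representation ℂ S.U ℂ := Representation.trivial ℂ S.U ℂ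
  let ω₁ : Representation ℂ S.U ℂ := (DistribMulAction.toModuleEnd ℂ ℂ).comp Ψ
  have hω₀ : ∀ (g : S.U) (x : ℂ), ω₀ g x = ((1 : S.U →* ℂˣ) g : ℂ) * x := fun g x => by
    rw [MonoidHom.one_apply, Units.val_one, one_mul]; rfl
  have hω₁ : ∀ (g : S.U) (x : ℂ), ω₁ g x = (Ψ g : ℂ) * x := fun g x => by
    change (Ψ g : ℂˣ) • x = _
    rw [Units.smul_def, smul_eq_mul]
  have hcen' : ∀ z : S.normOne, Ψ (S.scalar z) = χ₀.1 z := fun z => by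
    rw [hcen z]; rfl
  let Lf : LemD1IndexedFamily (v.adicCompletion F) (LocalRing E v) N (Fin 2) :=
    { isNonarchimedeanLocalField := inferInstance
      isModuleTopology := LemD1OfPlace.isModuleTopology_localRing E v
      S := S
      mu := fun _ => μ
      eps := ![e, e']
      chi := fun _ => χ₀
      V := fun _ => ℂ
      omega := ![ω₀, ω₁] }
  have hεne : ¬ LemD1.SameClass (Lf.eps 0) (Lf.eps 1) := hee'
  have hεne' : ¬ LemD1.SameClass (Lf.eps 1) (Lf.eps 0) := fun h => hee' (sameClass_symm h)
  have hN₁ : augmentation (Lf.single 1).omega (Lf.single 1).S.scalar (Lf.single 1).chi = ⊥ :=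
    augmentation_eq_bot_of_character (Lf.single 1) Ψ hω₁ hcen'
  have hg₀ : Ψ g₀ ≠ (1 : S.U →* ℂˣ) g₀ := by rwa [MonoidHom.one_apply]
  have hnotiso : ¬ AreIsomorphicRep (Lf.quot 1) (Lf.quot 0) :=
    not_areIsomorphicRep_quotRep_of_characters ω₁ ω₀ S.scalar_mem_center χ₀.1 χ₀.1 Ψ 1 hω₁ hω₀ hN₁ hg₀
  have hItem1 : Lf.Item1AsPrinted := by
    intro i
    fin_cases i
    · exact lemD1_1AsPrinted_of_character_of_rank_ne_two' (Lf.single 0) 1 hω₀ (fun z => rfl)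
        ⟨Set.univ, isOpen_univ, Set.mem_univ _, fun g _ => rfl⟩ hN2
    · exact lemD1_1AsPrinted_of_character_of_rank_ne_two' (Lf.single 1) Ψ hω₁ hcen' hopen hN2
  have hrefl : ∀ k : Fin 2, (AreIsomorphicRep (Lf.quot k) (Lf.quot k) ↔
      (Lf.mu k = Lf.mu k ∧ LemD1.SameClass (Lf.eps k) (Lf.eps k) ∧ Lf.chi k = Lf.chi k)) :=
    fun k => iff_of_true ⟨LinearEquiv.refl ℂ _, fun _ _ => rfl⟩ ⟨rfl, ⟨1, by simp⟩, rfl⟩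
  have hItem3 : LemD1_3AsPrintedI Lf := by
    intro _ i j
    fin_cases i <;> fin_cases j
    · exact hrefl 0
    · exact iff_of_false hnotiso fun h => hεne h.2.1
    · exact iff_of_false (fun h => hnotiso h.symm) fun h => hεne' h.2.1
    · exact hrefl 1
  exact ⟨Lf, rfl, rfl, rfl, fun _ => rfl, fun _ => rfl, hItem1, hItem3, rfl, hεne, rfl, hnotiso⟩

include hcδ in
/-- **(1) ∧ (3) JOINTLY with the `ε`-CONJUNCT ALONE SEPARATING — every NON-SPLIT place `w ∣ v` carrying a global norm-one unit `ζ ∈ E` with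
`v_w(ζ − 1) ≠ 0`, `v_w(ζ^N − 1) < v_w(ζ − 1)`**, every `N ≥ 3`, ANY quadratic `E/F`: for every `μ ∈ MuSet S` and every representative `e` there is
an INEQUIVALENT representative `e'` (✔ `…NonsplitPlace.exists_epsRep_not_sameClass_of_nonsplit`) and the two-member collection with labels
`(μ, e, 1)`, `(μ, e', 1)` and carriers the trivial line and the line of the carrier character of ✔ `…InertCarrier.exists_carrier_character_of_norm_one`
satisfies [Lem. D.1, first sentence + (1)] AS PRINTED member by member AND [Lem. D.1 (3)] AS PRINTED for all four pairs; exactly the `ε`-conjunct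
fails; the `ω`'s are non-isomorphic with EQUAL central characters. [cite: Liu2021, App. D Lemma D.1 (1) and (3) (l. 5229, 5233)] -/
theorem exists_lemD1IndexedFamily_item1_and_lemD1_3_eps_of_norm_one (w : PlacesOver E v) (hw : c • w.1 = w.1) (ζ : E)
    (hζc : ζ * c ζ = 1) (hζ0 : w.1.valuation E (ζ - 1) ≠ 0) (hζN : w.1.valuation E (ζ ^ N - 1) < w.1.valuation E (ζ - 1))
    (h3 : 3 ≤ N) (μ : LemD1.MuSet (LemD1OfPlace.standingData E v c N J hcδ hδ hN hJh hJdet))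
    (e : LemD1.EpsRep (LemD1OfPlace.standingData E v c N J hcδ hδ hN hJh hJdet)) :
    ∃ Lf : LemD1IndexedFamily (v.adicCompletion F) (LocalRing E v) N (Fin 2),
      Lf.S = LemD1OfPlace.standingData E v c N J hcδ hδ hN hJh hJdet ∧
      (Lf.eps 0).1 = e.1 ∧ (∀ i, (Lf.mu i).1 = μ.1) ∧ (∀ i, (Lf.chi i).1 = 1) ∧
      Lf.Item1AsPrinted ∧ LemD1_3AsPrintedI Lf ∧
      Lf.mu 0 = Lf.mu 1 ∧ ¬ LemD1.SameClass (Lf.eps 0) (Lf.eps 1) ∧ Lf.chi 0 = Lf.chi 1 ∧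
      ¬ AreIsomorphicRep (Lf.quot 1) (Lf.quot 0) := by
  obtain ⟨e', hee'⟩ := LemD1IndexedNonVacuityNonsplitPlace.exists_epsRep_not_sameClass_of_nonsplit E v c hcδ hδ N J hN hJh hJdet w hw e
  obtain ⟨Ψ, hcen, hopen, hne, -, -⟩ :=
    LemD1IndexedNonVacuityInertCarrier.exists_carrier_character_of_norm_one E v c hcδ hδ N J hN hJh hJdet w hw ζ hζc hζ0 hζN
  obtain ⟨Lf, hS, h0, -, hμ, hχ, h1, h3', hμeq, hε, hχeq, hnot⟩ :=
    exists_family_eps_of_central_trivial_character E v c hcδ hδ N J hN hJh hJdet h3 μ e e' hee' Ψ hcen hopen hne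
  exact ⟨Lf, hS, h0, hμ, hχ, h1, h3', hμeq, hε, hχeq, hnot⟩

include hcδ in
/-- **(1) ∧ (3) JOINTLY with the `ε`-CONJUNCT ALONE SEPARATING — every INERT place with `gcd(N, q_v + 1) > 1`** (`v` unramified in `E`,
`c • w = w`, `N ≥ 3` not coprime to `q_v + 1`; ANY quadratic `E/F`, NO torsion, NO `w ∣ N`), the carrier being the inert carrier of
✔ `…InertCarrier.exists_inert_carrier_character`. [cite: Liu2021, App. D Lemma D.1 (1) and (3) (l. 5229, 5233)] -/
theorem exists_lemD1IndexedFamily_item1_and_lemD1_3_eps_of_inert (hv : Algebra.IsUnramifiedIn (𝓞 E) v.asIdeal) (w : PlacesOver E v)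
    (hw : c • w.1 = w.1) (hNq : ¬ Nat.Coprime N (Nat.card (𝓞 F ⧸ v.asIdeal) + 1)) (h3 : 3 ≤ N)
    (μ : LemD1.MuSet (LemD1OfPlace.standingData E v c N J hcδ hδ hN hJh hJdet))
    (e : LemD1.EpsRep (LemD1OfPlace.standingData E v c N J hcδ hδ hN hJh hJdet)) :
    ∃ Lf : LemD1IndexedFamily (v.adicCompletion F) (LocalRing E v) N (Fin 2),
      Lf.S = LemD1OfPlace.standingData E v c N J hcδ hδ hN hJh hJdet ∧
      (Lf.eps 0).1 = e.1 ∧ (∀ i, (Lf.mu i).1 = μ.1) ∧ (∀ i, (Lf.chi i).1 = 1) ∧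
      Lf.Item1AsPrinted ∧ LemD1_3AsPrintedI Lf ∧
      Lf.mu 0 = Lf.mu 1 ∧ ¬ LemD1.SameClass (Lf.eps 0) (Lf.eps 1) ∧ Lf.chi 0 = Lf.chi 1 ∧
      ¬ AreIsomorphicRep (Lf.quot 1) (Lf.quot 0) := by
  obtain ⟨e', hee'⟩ := LemD1IndexedNonVacuityNonsplitPlace.exists_epsRep_not_sameClass_of_nonsplit E v c hcδ hδ N J hN hJh hJdet w hw e
  obtain ⟨Ψ, hcen, hopen, hne, -, -⟩ :=
    LemD1IndexedNonVacuityInertCarrier.exists_inert_carrier_character E v c hcδ hδ N J hN hJh hJdet hv w hw hNq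
  obtain ⟨Lf, hS, h0, -, hμ, hχ, h1, h3', hμeq, hε, hχeq, hnot⟩ :=
    exists_family_eps_of_central_trivial_character E v c hcδ hδ N J hN hJh hJdet h3 μ e e' hee' Ψ hcen hopen hne
  exact ⟨Lf, hS, h0, hμ, hχ, h1, h3', hμeq, hε, hχeq, hnot⟩

include hcδ in
/-- **Consequence — every NON-SPLIT place carrying a global norm-one unit `ζ` with `v_w(ζ − 1) ≠ 0`, `v_w(ζ^N − 1) < v_w(ζ − 1)`, every
`N ≥ 3`, NO hypothesis on `μ`** (✔ `…NormClassExtensionDyadic.nonempty_muSet`): the records (1) ∧ (3) read on an indexed collection over the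
place model do NOT by their shape force «same `μ` ∧ same `χ` ⟹ same `ε`-class». [cite: Liu2021, App. D Lemma D.1 (1) and (3) (l. 5229, 5233)] -/
theorem not_forall_sameClass_of_mu_eq_of_chi_eq_of_norm_one (w : PlacesOver E v) (hw : c • w.1 = w.1) (ζ : E)
    (hζc : ζ * c ζ = 1) (hζ0 : w.1.valuation E (ζ - 1) ≠ 0) (hζN : w.1.valuation E (ζ ^ N - 1) < w.1.valuation E (ζ - 1))
    (h3 : 3 ≤ N) :
    ¬ ∀ Lf : LemD1IndexedFamily (v.adicCompletion F) (LocalRing E v) N (Fin 2),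
        Lf.S = LemD1OfPlace.standingData E v c N J hcδ hδ hN hJh hJdet →
        Lf.Item1AsPrinted → LemD1_3AsPrintedI Lf →
        ∀ i j : Fin 2, Lf.mu i = Lf.mu j → Lf.chi i = Lf.chi j → LemD1.SameClass (Lf.eps i) (Lf.eps j) := by
  obtain ⟨μ⟩ := LemD1IndexedNonVacuityNormClassExtensionDyadic.nonempty_muSet E v c hcδ hδ N J hN hJh hJdet
  intro h
  obtain ⟨Lf, hS, -, -, -, h1, h3', hμ, hε, hχ, -⟩ :=
    exists_lemD1IndexedFamily_item1_and_lemD1_3_eps_of_norm_one E v c hcδ hδ N J hN hJh hJdet w hw ζ hζc hζ0 hζN h3 μ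
      (LemD1OfPlace.epsDelta E v c N J hcδ hδ hN hJh hJdet)
  exact hε (h Lf hS h1 h3' 0 1 hμ hχ)

include hcδ in
/-- **Consequence — every INERT place with `gcd(N, q_v + 1) > 1`, every `N ≥ 3`, NO hypothesis on `μ`.**
[cite: Liu2021, App. D Lemma D.1 (1) and (3) (l. 5229, 5233)] -/
theorem not_forall_sameClass_of_mu_eq_of_chi_eq_of_inert (hv : Algebra.IsUnramifiedIn (𝓞 E) v.asIdeal) (w : PlacesOver E v)
    (hw : c • w.1 = w.1) (hNq : ¬ Nat.Coprime N (Nat.card (𝓞 F ⧸ v.asIdeal) + 1)) (h3 : 3 ≤ N) :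
    ¬ ∀ Lf : LemD1IndexedFamily (v.adicCompletion F) (LocalRing E v) N (Fin 2),
        Lf.S = LemD1OfPlace.standingData E v c N J hcδ hδ hN hJh hJdet →
        Lf.Item1AsPrinted → LemD1_3AsPrintedI Lf →
        ∀ i j : Fin 2, Lf.mu i = Lf.mu j → Lf.chi i = Lf.chi j → LemD1.SameClass (Lf.eps i) (Lf.eps j) := by
  obtain ⟨μ⟩ := LemD1IndexedNonVacuityNormClassExtensionDyadic.nonempty_muSet E v c hcδ hδ N J hN hJh hJdet
  intro h
  obtain ⟨Lf, hS, -, -, -, h1, h3', hμ, hε, hχ, -⟩ :=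
    exists_lemD1IndexedFamily_item1_and_lemD1_3_eps_of_inert E v c hcδ hδ N J hN hJh hJdet hv w hw hNq h3 μ
      (LemD1OfPlace.epsDelta E v c N J hcδ hδ hN hJh hJdet)
  exact hε (h Lf hS h1 h3' 0 1 hμ hχ)

end PlaceModel

/-! ## §2 The CM rows at the INERT places `v` of `L⁺` with `gcd(N, q_v + 1) > 1` (for the END: `q_v ≡ 2 (mod 3)`) -/

section CM

open Literature.NumberTheory.GelbartRogawski1991.UnitaryDualPair (imagUnit complexConj_imagUnit imagUnit_ne_zero)
open Literature.NumberTheory.GelbartRogawski1991.UnitaryDualPair.LocalSplitting (localMu norm_localMu continuous_localMu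
  localMu_toLocalRing_eq_one_iff)
open Literature.NumberTheory.Automorphic.IdeleClassGroup (toHeckeCharacter isUnitary_toHeckeCharacter IsConjugateSymplectic)
open Literature.RepresentationTheory.Liu2021 (isOscillatorChar_toHeckeCharacter_iff)

variable (L : Type) [Field L] [NumberField L] [IsCMField L]

local notation3 "cc" => (IsCMField.complexConj L)
local notation3 "L⁺" => (↥(maximalRealSubfield L))

variable (v : HeightOneSpectrum (𝓞 (maximalRealSubfield L))) (N : ℕ) (J : Matrix (Fin N) (Fin N) L) (hN : 2 ≤ N)
  (hJh : (J.map (IsCMField.complexConj L))ᵀ = J) (hJdet : J.det ≠ 0)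

/-- **the `ε`-alone certificate with the rows' OWN `μ_v` in BOTH members — INERT `w ∣ v` (`v` unramified in `L`, `\bar w = w`) with
`gcd(N, q_v + 1) > 1`** (ANY CM field, no root of unity, `v ∤ N` allowed), every `N ≥ 3`, every conjugate symplectic `ψ`: labels `(μ_v, ε, 1)`,
`(μ_v, ε', 1)` with `μ_v = localMu L (toHeckeCharacter L ψ) v` and `ε' ≁ ε`; (1) ∧ (3) hold, only the `ε`-slots differ in class, the `ω`'s
non-isomorphic. [cite: Liu2021, App. D Lemma D.1 (1) and (3) (l. 5229, 5233); Def. 4.11 (l. 2086)] -/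
theorem exists_lemD1IndexedFamily_item1_and_lemD1_3_localMu_eps_of_inert (hv : Algebra.IsUnramifiedIn (𝓞 L) v.asIdeal)
    (w : PlacesOver L v) (hw : cc • w.1 = w.1) (hNq : ¬ Nat.Coprime N (Nat.card (𝓞 L⁺ ⧸ v.asIdeal) + 1)) (h3 : 3 ≤ N)
    (ψ : IdeleClassGroup L →ₜ* Circle) (hψ : IsConjugateSymplectic L ψ) :
    ∃ Lf : LemD1IndexedFamily (v.adicCompletion L⁺) (LocalRing L v) N (Fin 2),
      Lf.S = LemD1OfPlace.standingData L v cc N J (complexConj_imagUnit L) (imagUnit_ne_zero L) hN hJh hJdet ∧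
      (Lf.eps 0).1 = (LemD1OfPlace.epsDelta L v cc N J (complexConj_imagUnit L) (imagUnit_ne_zero L) hN hJh hJdet).1 ∧
      (∀ i, (Lf.mu i).1 = localMu L (toHeckeCharacter L ψ) v) ∧ (∀ i, (Lf.chi i).1 = 1) ∧
      Lf.Item1AsPrinted ∧ LemD1_3AsPrintedI Lf ∧
      Lf.mu 0 = Lf.mu 1 ∧ ¬ LemD1.SameClass (Lf.eps 0) (Lf.eps 1) ∧ Lf.chi 0 = Lf.chi 1 ∧
      ¬ AreIsomorphicRep (Lf.quot 1) (Lf.quot 0) :=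
  exists_lemD1IndexedFamily_item1_and_lemD1_3_eps_of_inert L v cc (complexConj_imagUnit L) (imagUnit_ne_zero L) N J hN hJh hJdet
    hv w hw hNq h3
    (LemD1OfPlace.muOf L v cc N J (complexConj_imagUnit L) (imagUnit_ne_zero L) hN hJh hJdet
      (localMu L (toHeckeCharacter L ψ) v)
      (fun x => norm_localMu L (toHeckeCharacter L ψ) v (isUnitary_toHeckeCharacter L ψ) x)
      (continuous_localMu L (toHeckeCharacter L ψ) v)
      (fun t => localMu_toLocalRing_eq_one_iff L (toHeckeCharacter L ψ) v
        ((isOscillatorChar_toHeckeCharacter_iff ψ).mpr hψ) t))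
    (LemD1OfPlace.epsDelta L v cc N J (complexConj_imagUnit L) (imagUnit_ne_zero L) hN hJh hJdet)

/-- **the records `hD1''` ∕ `hD3` read at the rows' slot types do not force «same `μ` ∧ same `χ` ⟹ same `ε`-class»** — ANY CM field, every
INERT place `w ∣ v` with `gcd(N, q_v + 1) > 1`, every `N ≥ 3`. [cite: Liu2021, App. D Lemma D.1 (1) and (3) (l. 5229, 5233)] -/
theorem not_forall_sameClass_of_mu_eq_of_chi_eq_of_isCMField_of_inert (hv : Algebra.IsUnramifiedIn (𝓞 L) v.asIdeal)
    (w : PlacesOver L v) (hw : cc • w.1 = w.1) (hNq : ¬ Nat.Coprime N (Nat.card (𝓞 L⁺ ⧸ v.asIdeal) + 1)) (h3 : 3 ≤ N) :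
    ¬ ∀ Lf : LemD1IndexedFamily (v.adicCompletion L⁺) (LocalRing L v) N (Fin 2),
        Lf.S = LemD1OfPlace.standingData L v cc N J (complexConj_imagUnit L) (imagUnit_ne_zero L) hN hJh hJdet →
        Lf.Item1AsPrinted → LemD1_3AsPrintedI Lf →
        ∀ i j : Fin 2, Lf.mu i = Lf.mu j → Lf.chi i = Lf.chi j → LemD1.SameClass (Lf.eps i) (Lf.eps j) :=
  not_forall_sameClass_of_mu_eq_of_chi_eq_of_inert L v cc (complexConj_imagUnit L) (imagUnit_ne_zero L) N J hN hJh hJdet hv w hw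
    hNq h3

/-- **THE END's CASE `3 ∣ N`: ANY CM field, every INERT place `w ∣ v` (`v` unramified in `L`) with `q_v ≡ 2 (mod 3)`** — the records do not
force «same `μ` ∧ same `χ` ⟹ same `ε`-class»; no `ζ_3 ∈ L`, no `v ∣ 3` needed. [cite: Liu2021, App. D Lemma D.1 (1) and (3) (l. 5229, 5233)] -/
theorem not_forall_sameClass_of_mu_eq_of_chi_eq_of_isCMField_of_three_dvd (hv : Algebra.IsUnramifiedIn (𝓞 L) v.asIdeal)
    (w : PlacesOver L v) (hw : cc • w.1 = w.1) (h3N : 3 ∣ N) (h3q : 3 ∣ Nat.card (𝓞 L⁺ ⧸ v.asIdeal) + 1) (h3 : 3 ≤ N) :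
    ¬ ∀ Lf : LemD1IndexedFamily (v.adicCompletion L⁺) (LocalRing L v) N (Fin 2),
        Lf.S = LemD1OfPlace.standingData L v cc N J (complexConj_imagUnit L) (imagUnit_ne_zero L) hN hJh hJdet →
        Lf.Item1AsPrinted → LemD1_3AsPrintedI Lf →
        ∀ i j : Fin 2, Lf.mu i = Lf.mu j → Lf.chi i = Lf.chi j → LemD1.SameClass (Lf.eps i) (Lf.eps j) :=
  not_forall_sameClass_of_mu_eq_of_chi_eq_of_isCMField_of_inert L v N J hN hJh hJdet hv w hw
    (Nat.not_coprime_of_dvd_of_dvd (by norm_num) h3N h3q) h3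

end CM

end Literature.NumberTheory.Automorphic.Liu2021.LemD1IndexedNonVacuityInertEpsAlone

end
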